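import Summits.PneNP.PneNP.Theorems.ChebyshevTracialDesignPsdCells
import HarnessLib

/-!
# Cell pnp-psdrank, route `ChebyshevTracialDesign`: the PIECES of the psd rung — weighted Kupavskii–Zakharov on the trace profile of a
# tight psd strategy, one piece at a time, modulo the dense non-crossing psd cell

Harmonic backbone of the crux `TracialDecayExp20` (stmt-PneNP-19878), brick 52 (prover g11): the psd twin of bricks 49 §2 / 50a
(`…RungPiecesOneSided.piece_value_le`, `…RungAssemblyAll.value_le_three_terms`) — steps S1/S2/S6 of the psd rung named in MEMO-12 §3 (3) and
MEMO-13 §3 (3) («weighted Kupavskii–Zakharov on `y(M) = tr(Y_M)/r` + brick 49's dichotomy»), with the Literature glue of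
`CutMatchingRestrictionStrategies` (lit g19, p536272) and `SpreadApproximationWeighted` (lit g18, p530418). For a tight-orthogonal psd rectangle
`(X, Y)` of dimension `r ≥ 1` (`IsPsdRect`), an exact design `(n, t = 2c'+1, T, D, B_v, C, w)`, a family `A` of `t`-cuts, and a weighted
spread approximation `Dk` of `(PM_n, y)` with the TRACE WEIGHT `y(M) = tr(Y_M)/r ∈ [0,1]` (parameter `τ ≥ 1`, cores `≤ q`):
* §1 bookkeeping — `sum_eq_remainder_add_piecesW` (split the matching side along `Dk`), `card_piecesW_le` (`k ≤ τ^{q+1}·n^q`, each piece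
  pays for its star), `isRelHomogeneousW_congr` (homogeneity only reads the weight on the family), the trace weight lies in `[0,1]`;
* §2 **`psd_piece_value_le`** — `Σ_{U∈A} Σ_{M ∈ ℱ_i} W(U,M)·tr(X_U Y_M) ≤ 4^q·B_v·r·√P_{D−4} + 2·4^q·(|⟨S_i⟩|/|PM_n|)·B_v·(Ψ + β)·r`: crossing cells by
  brick 51's `abs_psd_crossing_cell_le`, non-crossing cells by brick 51's `psd_noncrossing_cell_le` and the DICHOTOMY on the two reduced TRACE
  densities — both `≥ exp(−c₀ dq m)` ⇒ the hypothesis `hH` (the DENSE NON-CROSSING PSD CELL: a tight psd strategy of `K_m` whose matching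
  side carries a `(PM_m, τ)`-homogeneous trace weight, both trace densities `≥ exp(−c₀ dq m)`, has value `≤ B_v·Ψ·r` against every reduced
  design of degree `D' ∈ [D−q, D]`), else the trace marginals of brick 51 give `≤ B_v·β·r`;
The three-term bound summing the pieces (`psd_value_le_three_terms`) and the `TracialValueLEAt` packaging are the next file (`…PsdAssembly`).
So the psd rung is REDUCED to its dense non-crossing cell `hH` — for `r = 1` that cell is discharged by bricks 46/47/50b modulo Keevash–Lifshitz
Thm 1.8 (`…ReducedSpreadCell.reduced_spreadCell_value_le_of_globalLevelD`); for `r > 1` it is the open core of the crux (MEMO-12 §2(d), MEMO-13 §3b: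
trace-spread does not control directions; an 'alignment lemma' is needed there).
[cite: Rothvoss2017, §2 (PDF p. 6)] [cite: KupavskiiZakharov2022, §2 and Lemma 11] [cite: BrietDadushPokutta2014, Thm. 6 (§3)]
Stature: support/instrument (no defs). WHAT THIS IS NOT: not a proof of the crux or of any psd rung (the dense cell is a hypothesis), nothing on
psd rank, no P-vs-NP content. Supports stmt-PneNP-19878.
-/

set_option linter.dupNamespace false -- `Summit.PneNP.PneNP.…`: summit = sub-problem (D-0017)

noncomputable section

namespace Summit.PneNP.PneNP.Theorems.ChebyshevTracialDesignPsdPieces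

open Finset Matrix Literature.Combinatorics.Optimization
open Literature.Barriers.PneNP hiding verts
open Literature.Combinatorics.SetFamily
open Literature.Combinatorics.SimpleGraph.CycleSpace
open Literature.Combinatorics.AssociationSchemes.CutMatchingRestriction
open Literature.Combinatorics.AssociationSchemes.CutMatchingRestrictionStrategies
open Literature.Combinatorics.AssociationSchemes.HomogeneousMatchingFamilies
open Summit.PneNP.PneNP.Theorems.ChebyshevTracialDesignProfilePolynomial (card_pmatch_pos)
open Summit.PneNP.PneNP.Theorems.ChebyshevTracialDesignDipoleHitRatio (card_pmatch_eq_pmCount)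
open Summit.PneNP.PneNP.Theorems.ChebyshevTracialDesignAPrioriBounds (trace_le_of_sub_posSemidef)
open Summit.PneNP.PneNP.Theorems.ChebyshevTracialDesignLevelTail (atten_factor_le_one)
open Summit.PneNP.PneNP.Theorems.ChebyshevTracialDesignRungCells
open Summit.PneNP.PneNP.Theorems.ChebyshevTracialDesignRungPieces
open Summit.PneNP.PneNP.Theorems.ChebyshevTracialDesignPsdCells

variable {n : ℕ}

/-! ### §1 Bookkeeping for the weighted spread approximation of the trace profile -/

/-- **Splitting the matching side along a weighted spread approximation**: `Σ_{M∈Y} g(M) = Σ_{M∈Y, M∈ℱ'} g(M) + Σ_i Σ_{M∈Y, M∈ℱ_i} g(M)`.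
[cite: KupavskiiZakharov2022, Lemma 11] -/
theorem sum_eq_remainder_add_piecesW {β : Type*} [AddCommMonoid β] (Y : Finset (PMatch n)) {y : Finset (Sym2 (Fin n)) → ℝ}
    {τ : ℝ} {q : ℕ} (Dk : WeightedSpreadApproximation (perfectMatchings (univ : Finset (Fin n))) (Y.image Subtype.val) y τ q)
    (g : PMatch n → β) :
    ∑ M ∈ Y, g M = ∑ M ∈ Y.filter (fun M => M.1 ∈ Dk.remainder), g M + ∑ i : Fin Dk.k, ∑ M ∈ Y.filter (fun M => M.1 ∈ Dk.piece i), g M := by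
  classical
  have hcover : Y = Y.filter (fun M => M.1 ∈ Dk.remainder) ∪
      (univ : Finset (Fin Dk.k)).biUnion (fun i => Y.filter (fun M => M.1 ∈ Dk.piece i)) := by
    ext M
    simp only [mem_union, mem_filter, mem_biUnion, mem_univ, true_and]
    constructor
    · intro hM
      have hMF : M.1 ∈ Y.image Subtype.val := mem_image_of_mem _ hM
      rw [← Dk.remainder_union_biUnion, mem_union, mem_biUnion] at hMF
      rcases hMF with h | ⟨i, -, hi⟩
      · exact Or.inl ⟨hM, h⟩
      · exact Or.inr ⟨i, hM, hi⟩
    · rintro (⟨hM, -⟩ | ⟨i, hM, -⟩) <;> exact hM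
  have hdisj1 : Disjoint (Y.filter (fun M => M.1 ∈ Dk.remainder))
      ((univ : Finset (Fin Dk.k)).biUnion (fun i => Y.filter (fun M => M.1 ∈ Dk.piece i))) := by
    rw [disjoint_biUnion_right]
    intro i _
    rw [disjoint_filter]
    intro M _ hrem hpi
    exact disjoint_left.1 (Dk.disjoint_remainder_piece i) hrem hpi
  have hdisj2 : ∀ i ∈ (univ : Finset (Fin Dk.k)), ∀ j ∈ (univ : Finset (Fin Dk.k)), i ≠ j →
      Disjoint (Y.filter (fun M => M.1 ∈ Dk.piece i)) (Y.filter (fun M => M.1 ∈ Dk.piece j)) := by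
    intro i _ j _ hij
    rw [disjoint_filter]
    intro M _ hi hj
    exact disjoint_left.1 (Dk.disjoint i j hij) hi hj
  conv_lhs => rw [hcover]
  rw [sum_union hdisj1, sum_biUnion hdisj2]

/-- **The number of weighted Kupavskii–Zakharov pieces** of a `[0,1]`-weight carried by perfect matchings of `K_n` (`n` even, `n ≥ 1`, cores `≤ q`,
parameter `τ > 0`): `k ≤ τ^{q+1}·n^q` — each piece pays for its star (`|⟨S_i⟩| ≤ τ^{q+1}·y(ℱ_i)`), stars have density `≥ n^{−q}`, the pieces are
disjoint and `y ≤ 1`. [cite: KupavskiiZakharov2022, Lemma 11 (procedure)] -/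
theorem card_piecesW_le (hn : Even n) (hn1 : 1 ≤ n) {ℱ : Finset (Finset (Sym2 (Fin n)))}
    (hℱ : ℱ ⊆ perfectMatchings (univ : Finset (Fin n))) {y : Finset (Sym2 (Fin n)) → ℝ} (hy0 : ∀ M, 0 ≤ y M) (hy1 : ∀ M, y M ≤ 1)
    {τ : ℝ} (hτ : 0 < τ) {q : ℕ} (Dk : WeightedSpreadApproximation (perfectMatchings (univ : Finset (Fin n))) ℱ y τ q) :
    (Dk.k : ℝ) ≤ τ ^ (q + 1) * (n : ℝ) ^ q := by
  have hPM : (0 : ℝ) < Fintype.card (PMatch n) := by exact_mod_cast card_pmatch_pos hn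
  have hpiece : ∀ i : Fin Dk.k, (Fintype.card (PMatch n) : ℝ) ≤ τ ^ (q + 1) * (n : ℝ) ^ q * wmass y (Dk.piece i) := by
    intro i
    have hS := isPMOn_verts_coreW hℱ Dk i
    have h1 := card_pmatch_le_pow_mul_card_star hS (Dk.card_core_le i) hn1
    have h2 := Dk.card_supersets_le i
    calc (Fintype.card (PMatch n) : ℝ) ≤ (n : ℝ) ^ q * (supersets (perfectMatchings univ) (Dk.core i)).card := h1
      _ ≤ (n : ℝ) ^ q * (τ ^ (q + 1) * wmass y (Dk.piece i)) := mul_le_mul_of_nonneg_left h2 (by positivity)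
      _ = τ ^ (q + 1) * (n : ℝ) ^ q * wmass y (Dk.piece i) := by ring
  have hsum : ∑ i : Fin Dk.k, wmass y (Dk.piece i) ≤ Fintype.card (PMatch n) := by
    refine (Dk.sum_wmass_piece_le hy0).trans ((wmass_le_card hy1 ℱ).trans ?_)
    rw [card_pmatch_eq_pmCount, pmCount]
    exact_mod_cast card_le_card hℱ
  have hk : (Dk.k : ℝ) * Fintype.card (PMatch n) ≤ τ ^ (q + 1) * (n : ℝ) ^ q * ∑ i : Fin Dk.k, wmass y (Dk.piece i) := by
    rw [mul_sum]
    have := sum_le_sum fun i (_ : i ∈ (univ : Finset (Fin Dk.k))) => hpiece i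
    rw [sum_const, card_univ, Fintype.card_fin, nsmul_eq_mul] at this
    exact this
  have := hk.trans (mul_le_mul_of_nonneg_left hsum (by positivity))
  exact le_of_mul_le_mul_right this hPM

/-- Relative homogeneity of a weight on a family only reads the weight ON the family. [cite: KupavskiiZakharov2022, §2] -/
theorem isRelHomogeneousW_congr {α : Type*} [DecidableEq α] {τ : ℝ} {𝒜 ℱ : Finset (Finset α)} {y y' : Finset α → ℝ}
    (h : ∀ A ∈ ℱ, y A = y' A) (hy : IsRelHomogeneousW τ 𝒜 y ℱ) : IsRelHomogeneousW τ 𝒜 y' ℱ := by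
  intro S
  have h1 : wmass y' (supersets ℱ S) = wmass y (supersets ℱ S) :=
    sum_congr rfl fun A hA => (h A (mem_supersets.1 hA).1).symm
  have h2 : wmass y' ℱ = wmass y ℱ := sum_congr rfl fun A hA => (h A hA).symm
  rw [h1, h2]
  exact hy S

/-- The trace weight `y(M) = tr(Y_M)/r` of the matching side of a psd rectangle, extended by `0` to all edge sets, lies in `[0, 1]`.
[cite: BrietDadushPokutta2014, Thm. 6 (§3)] -/
theorem traceWeight_mem {r : ℕ} {X : OddSet n → Matrix (Fin r) (Fin r) ℝ} {Y : PMatch n → Matrix (Fin r) (Fin r) ℝ} (hXY : IsPsdRect X Y)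
    (M : Finset (Sym2 (Fin n))) :
    0 ≤ (fun M : Finset (Sym2 (Fin n)) => if hM : IsPMOn univ M then (Y ⟨M, hM⟩).trace / r else 0) M ∧
      (fun M : Finset (Sym2 (Fin n)) => if hM : IsPMOn univ M then (Y ⟨M, hM⟩).trace / r else 0) M ≤ 1 := by
  dsimp only
  split_ifs with hM
  · refine ⟨div_nonneg (hXY.2.1 ⟨M, hM⟩).1.trace_nonneg (Nat.cast_nonneg r), ?_⟩
    rcases Nat.eq_zero_or_pos r with hr | hr
    · subst hr; simp
    · rw [div_le_one (by exact_mod_cast hr)]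
      exact trace_le_of_sub_posSemidef (hXY.2.1 ⟨M, hM⟩).2
  · exact ⟨le_rfl, zero_le_one⟩

/-- The trace mass of a sub-family `B ⊆ PM_n` is `r` times the mass of the trace weight on its edge sets. [folklore] -/
theorem sum_trace_eq_mul_wmass {r : ℕ} (hr : 0 < r) (Y : PMatch n → Matrix (Fin r) (Fin r) ℝ) (B : Finset (PMatch n)) :
    ∑ M ∈ B, (Y M).trace =
      (r : ℝ) * wmass (fun M : Finset (Sym2 (Fin n)) => if hM : IsPMOn univ M then (Y ⟨M, hM⟩).trace / r else 0) (B.image Subtype.val) := by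
  rw [wmass_image_val_dite (fun M => (Y M).trace / r) B, mul_sum]
  refine sum_congr rfl fun M _ => ?_
  have hr' : (r : ℝ) ≠ 0 := by exact_mod_cast hr.ne'
  field_simp

/-! ### §2 One piece of the weighted spread approximation -/

/-- **A non-crossing cell of one piece: the dichotomy.** In the setting of `psd_piece_value_le` below, for a non-crossing pattern `π ⊆ V_i`
(`crossCount π S_i = 0`): `Σ_{U∈A, U∩V_i=π} Σ_{M∈ℱ_i} W(U,M)·tr(X_U Y_M) ≤ 2·(|PM_m|/|PM_n|)·B_v·(Ψ + β)·r`, `m = n − |V_i|` — brick 51's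
`psd_noncrossing_cell_le` with its reduced-strategy hypothesis discharged by the DICHOTOMY: both reduced trace densities `≥ exp(−c₀ dq m)` ⇒ the
dense-cell hypothesis `hH` (the reduced trace weight is `(PM_m, τ)`-homogeneous on the reduced piece by
`isRelHomogeneousW_pmCellMatchings_piece`, the reduced strategy is a tight psd rectangle by `IsPsdRect.lift`); else brick 51's trace marginals.
[cite: Rothvoss2017, §2 (PDF p. 6)] [cite: KupavskiiZakharov2022, Lemma 11] [cite: BrietDadushPokutta2014, Thm. 6 (§3)] -/
theorem psd_noncrossing_pattern_le {c' T Dg q n₁ r : ℕ} {Bv τ c₀ β Ψ : ℝ} {C : Finset ℕ} {w : ℕ → ℝ} (hn : Even n) (hr : 0 < r)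
    (hdes : IsExactDesign n (2 * c' + 1) T Dg Bv C w)
    (hbal : n ≤ 4 * (2 * c' + 1)) (hq : 40 * q ≤ n) (hn₁ : n₁ + 2 * q ≤ n)
    (hTq : T + 2 * q + 2 ≤ 2 * c' + 1) (hqD : q ≤ Dg) (hDq3 : Dg + 2 * q + 3 ≤ 2 * c' + 1) (hqN : 2 * q * q + q ≤ n / 2)
    (hH : ∀ (m t'' D' : ℕ) (w' : ℕ → ℝ), n₁ ≤ m → Even m → Odd t'' → m ≤ 5 * t'' → m ≤ 5 * (m - t'') →
      T ≤ t'' → T ≤ m - t'' → D' + 3 ≤ t'' → D' + 3 ≤ m - t'' → Dg ≤ D' + q → D' ≤ Dg →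
      (∀ c ∈ C, (Qset m t'' c).Nonempty) →
      (∀ p : Polynomial ℝ, p.natDegree ≤ D' → ∑ c ∈ C, w' c * p.eval (c : ℝ) = -p.eval 0) →
      ∑ c ∈ C, |w' c| ≤ Bv →
      ∀ (X' : OddSet m → Matrix (Fin r) (Fin r) ℝ) (Y' : PMatch m → Matrix (Fin r) (Fin r) ℝ), IsPsdRect X' Y' →
      ∀ (A' : Finset (OddSet m)), (∀ U ∈ A', U.1.card = t'') →
      ∀ (B' : Finset (PMatch m)),
      IsRelHomogeneousW τ (perfectMatchings (univ : Finset (Fin m)))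
        (fun M : Finset (Sym2 (Fin m)) => if hM : IsPMOn univ M then (Y' ⟨M, hM⟩).trace / r else 0) (B'.image Subtype.val) →
      Real.exp (-(c₀ * dq m)) ≤ (∑ U ∈ A', (X' U).trace) / ((r : ℝ) * (m.choose t'' : ℝ)) →
      Real.exp (-(c₀ * dq m)) ≤ (∑ M ∈ B', (Y' M).trace) / ((r : ℝ) * (Fintype.card (PMatch m) : ℝ)) →
      ∑ U ∈ A', ∑ M ∈ B', levelWeight m t'' C w' U M * (X' U * Y' M).trace ≤ Bv * Ψ * r)
    (hΨ : 0 ≤ Ψ) (hβ : ∀ m : ℕ, n ≤ m + 2 * q → m ≤ n → Real.exp (-(c₀ * dq m)) ≤ β) (hβ0 : 0 ≤ β)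
    {X : OddSet n → Matrix (Fin r) (Fin r) ℝ} {Y : PMatch n → Matrix (Fin r) (Fin r) ℝ} (hXY : IsPsdRect X Y)
    (A : Finset (OddSet n)) (hA : ∀ U ∈ A, U.1.card = 2 * c' + 1) (B : Finset (PMatch n))
    (Dk : WeightedSpreadApproximation (perfectMatchings (univ : Finset (Fin n))) (B.image Subtype.val)
      (fun M : Finset (Sym2 (Fin n)) => if hM : IsPMOn univ M then (Y ⟨M, hM⟩).trace / r else 0) τ q) (i : Fin Dk.k)
    {π : Finset (Fin n)} (hπV' : π ⊆ verts (Dk.core i)) (hπ0 : crossCount π (Dk.core i) = 0) :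
    ∑ U ∈ A.filter (fun U => U.1 ∩ verts (Dk.core i) = π), ∑ M ∈ B.filter (fun M => M.1 ∈ Dk.piece i),
        levelWeight n (2 * c' + 1) C w U M * (X U * Y M).trace ≤
      2 * ((Fintype.card (PMatch (n - (verts (Dk.core i)).card)) : ℝ) / Fintype.card (PMatch n)) * (Bv * ((Ψ + β) * r)) := by
  classical
  have hS : IsPMOn (verts (Dk.core i)) (Dk.core i) := isPMOn_verts_coreW (image_val_subset B) Dk i
  have hBiS : ∀ M ∈ B.filter (fun M => M.1 ∈ Dk.piece i), Dk.core i ⊆ M.1 :=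
    fun M hM => Dk.core_subset_of_mem_piece (mem_filter.1 hM).2
  have hVcard : (verts (Dk.core i)).card = 2 * (Dk.core i).card := hS.two_mul_card.symm
  have hSq : (Dk.core i).card ≤ q := Dk.card_core_le i
  have hVn : (verts (Dk.core i)).card ≤ n := by simpa using card_le_univ (verts (Dk.core i))
  have hm : (univ \ verts (Dk.core i)).card = n - (verts (Dk.core i)).card := by rw [card_univ_sdiff, Fintype.card_fin]
  have hBv : 0 ≤ Bv := (sum_nonneg fun c _ => abs_nonneg (w c)).trans hdes.2.2.2.2.2.2
  have ht2 : 2 * (2 * c' + 1) + 2 ≤ n := hdes.2.1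
  have hr' : (0 : ℝ) < r := by exact_mod_cast hr
  set m := n - (verts (Dk.core i)).card with hmdef
  have hπe : Even π.card := by
    have := even_card_inter_of_crossCount_eq_zero hS hπ0
    rwa [inter_eq_left.2 hπV'] at this
  have hsN : 2 * (Dk.core i).card * (Dk.core i).card + (Dk.core i).card ≤ n / 2 :=
    (Nat.add_le_add (Nat.mul_le_mul (Nat.mul_le_mul_left 2 hSq) hSq) hSq).trans hqN
  have hΦ0 : 0 ≤ (Ψ + β) * r := mul_nonneg (add_nonneg hΨ hβ0) hr'.le
  refine psd_noncrossing_cell_le (s := (Dk.core i).card) hn hdes hS hVcard (by omega) (by omega)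
    hsN hπ0 hπV' hπe hm X Y A _ hBiS hΦ0 ?_
  -- the dichotomy in the reduced instance; first the arithmetic of the reduced parameters
  intro hQm w' hexact' hvar'
  have hπcard : π.card ≤ 2 * q := (card_le_card hπV').trans (by omega)
  have hodd : Odd (2 * c' + 1 - π.card) := by obtain ⟨p, hp⟩ := hπe; exact ⟨c' - p, by omega⟩
  have hmq : n ≤ m + 2 * q := by omega
  have hmn : m ≤ n := Nat.sub_le _ _
  have hβm := hβ m hmq hmn
  have hevm : Even m := by obtain ⟨p, hp⟩ := hn; exact ⟨p - (Dk.core i).card, by omega⟩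
  have ha1 : n₁ ≤ m := by omega
  have ha2 : m ≤ 5 * (2 * c' + 1 - π.card) := by omega
  have ha3 : m ≤ 5 * (m - (2 * c' + 1 - π.card)) := by omega
  have ha4 : T ≤ 2 * c' + 1 - π.card := by omega
  have ha5 : T ≤ m - (2 * c' + 1 - π.card) := by omega
  have ha6 : Dg - (Dk.core i).card + 3 ≤ 2 * c' + 1 - π.card := by omega
  have ha7 : Dg - (Dk.core i).card + 3 ≤ m - (2 * c' + 1 - π.card) := by omega
  have ha8 : Dg ≤ Dg - (Dk.core i).card + q := by omega
  have ha9 : Dg - (Dk.core i).card ≤ Dg := by omega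
  have ht''pos : 2 * c' + 1 - π.card ≤ m := by omega
  obtain ⟨hhom, -, -⟩ := isRelHomogeneousW_pmCellMatchings_piece B Dk i hm
  set X' : OddSet m → Matrix (Fin r) (Fin r) ℝ := fun Ut => X (liftOdd (verts (Dk.core i)) π hm hπV' hπe Ut) with hX'
  set Y' : PMatch m → Matrix (Fin r) (Fin r) ℝ := fun Mt => Y (liftPMatch (verts (Dk.core i)) (Dk.core i) hm hS Mt) with hY'
  have hX'Y' : IsPsdRect X' Y' := IsPsdRect.lift hS hm hπV' hπe hπ0 hXY
  set A' := oddCellCuts A (verts (Dk.core i)) π hm with hA'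
  set B' := pmCellMatchings (B.filter fun M => M.1 ∈ Dk.piece i) (verts (Dk.core i)) (Dk.core i) hm with hB'
  have hA't : ∀ U ∈ A', U.1.card = 2 * c' + 1 - π.card := fun U hU => card_of_mem_oddCellCuts hA hU
  -- homogeneity of the reduced trace weight on the reduced piece
  have hhom' : IsRelHomogeneousW τ (perfectMatchings (univ : Finset (Fin m)))
      (fun M : Finset (Sym2 (Fin m)) => if hM : IsPMOn univ M then (Y' ⟨M, hM⟩).trace / r else 0) (B'.image Subtype.val) := by
    refine isRelHomogeneousW_congr (fun M hM => ?_) hhom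
    obtain ⟨Mt, -, rfl⟩ := mem_image.1 hM
    have := dite_weight_lift hS hm (fun M => (Y M).trace / r) Mt
    dsimp only at this ⊢
    rw [this, dif_pos Mt.2]
  -- the summand is the reduced strategy's
  change ∑ U ∈ A', ∑ M ∈ B', levelWeight m (2 * c' + 1 - π.card) C w' U M * (X' U * Y' M).trace ≤ Bv * ((Ψ + β) * r)
  have htrY : 0 ≤ ∑ M ∈ B', (Y' M).trace := sum_nonneg fun M _ => (hX'Y'.2.1 M).1.trace_nonneg
  have htrX : 0 ≤ ∑ U ∈ A', (X' U).trace := sum_nonneg fun U _ => (hX'Y'.1 U).1.trace_nonneg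
  -- trace marginals in the reduced instance
  have hcol : ∑ U ∈ A', ∑ M ∈ B', levelWeight m (2 * c' + 1 - π.card) C w' U M * (X' U * Y' M).trace ≤
      Bv * ((∑ M ∈ B', (Y' M).trace) / Fintype.card (PMatch m)) :=
    (le_abs_self _).trans ((abs_cell_value_le_col hr C w' hX'Y' A' B').trans
      (mul_le_mul_of_nonneg_right hvar' (div_nonneg htrY (Nat.cast_nonneg _))))
  have hrow : ∑ U ∈ A', ∑ M ∈ B', levelWeight m (2 * c' + 1 - π.card) C w' U M * (X' U * Y' M).trace ≤
      Bv * ((∑ U ∈ A', (X' U).trace) / (m.choose (2 * c' + 1 - π.card) : ℝ)) := by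
    have h1 := abs_cell_value_le_row (t := 2 * c' + 1 - π.card) hr C w' hX'Y' A' B'
    rw [filter_true_of_mem hA't, card_tcuts_eq_choose hodd] at h1
    exact (le_abs_self _).trans (h1.trans (mul_le_mul_of_nonneg_right hvar' (div_nonneg htrX (Nat.cast_nonneg _))))
  have hΨβ : β * r ≤ (Ψ + β) * r := mul_le_mul_of_nonneg_right (by linarith) hr'.le
  by_cases hdX : Real.exp (-(c₀ * dq m)) ≤ (∑ U ∈ A', (X' U).trace) / ((r : ℝ) * (m.choose (2 * c' + 1 - π.card) : ℝ))
  · by_cases hdY : Real.exp (-(c₀ * dq m)) ≤ (∑ M ∈ B', (Y' M).trace) / ((r : ℝ) * (Fintype.card (PMatch m) : ℝ))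
    · -- dense × dense: the dense non-crossing psd cell
      have hv := hH m (2 * c' + 1 - π.card) (Dg - (Dk.core i).card) w' ha1 hevm hodd ha2 ha3 ha4 ha5 ha6 ha7 ha8 ha9
        hQm hexact' hvar' X' Y' hX'Y' A' hA't B' hhom' hdX hdY
      have hΨr : Ψ * r ≤ (Ψ + β) * r := mul_le_mul_of_nonneg_right (by linarith) hr'.le
      calc _ ≤ Bv * Ψ * r := hv
        _ = Bv * (Ψ * r) := mul_assoc _ _ _
        _ ≤ Bv * ((Ψ + β) * r) := mul_le_mul_of_nonneg_left hΨr hBv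
    · push Not at hdY
      have hPMm : (0 : ℝ) < Fintype.card (PMatch m) := by exact_mod_cast card_pmatch_pos hevm
      have hdY' : (∑ M ∈ B', (Y' M).trace) / Fintype.card (PMatch m) ≤ β * r := by
        rw [div_le_iff₀ hPMm]
        have h1 := ((div_lt_iff₀ (mul_pos hr' hPMm)).1 hdY).le
        calc ∑ M ∈ B', (Y' M).trace ≤ Real.exp (-(c₀ * dq m)) * ((r : ℝ) * Fintype.card (PMatch m)) := h1
          _ ≤ β * ((r : ℝ) * Fintype.card (PMatch m)) := mul_le_mul_of_nonneg_right hβm (mul_pos hr' hPMm).le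
          _ = β * r * Fintype.card (PMatch m) := by ring
      calc _ ≤ Bv * ((∑ M ∈ B', (Y' M).trace) / Fintype.card (PMatch m)) := hcol
        _ ≤ Bv * (β * r) := mul_le_mul_of_nonneg_left hdY' hBv
        _ ≤ Bv * ((Ψ + β) * r) := mul_le_mul_of_nonneg_left hΨβ hBv
  · push Not at hdX
    have hCm : (0 : ℝ) < (m.choose (2 * c' + 1 - π.card) : ℝ) := by exact_mod_cast Nat.choose_pos ht''pos
    have hdX' : (∑ U ∈ A', (X' U).trace) / (m.choose (2 * c' + 1 - π.card) : ℝ) ≤ β * r := by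
      rw [div_le_iff₀ hCm]
      have h1 := ((div_lt_iff₀ (mul_pos hr' hCm)).1 hdX).le
      calc ∑ U ∈ A', (X' U).trace ≤ Real.exp (-(c₀ * dq m)) * ((r : ℝ) * (m.choose (2 * c' + 1 - π.card) : ℝ)) := h1
        _ ≤ β * ((r : ℝ) * (m.choose (2 * c' + 1 - π.card) : ℝ)) := mul_le_mul_of_nonneg_right hβm (mul_pos hr' hCm).le
        _ = β * r * (m.choose (2 * c' + 1 - π.card) : ℝ) := by ring
    calc _ ≤ Bv * ((∑ U ∈ A', (X' U).trace) / (m.choose (2 * c' + 1 - π.card) : ℝ)) := hrow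
      _ ≤ Bv * (β * r) := mul_le_mul_of_nonneg_left hdX' hBv
      _ ≤ Bv * ((Ψ + β) * r) := mul_le_mul_of_nonneg_left hΨβ hBv

/-- **The value of a tight psd strategy on one weighted Kupavskii–Zakharov piece of its trace profile.** Let `n` be even, `(n, t = 2c'+1, T, D, B_v, C, w)`
an exact design with `4 ≤ D ≤ 2c'`, `n ≤ 4t`, `T + 2q + 2 ≤ t`, `q ≤ D`, `D + 2q + 3 ≤ t`, `2q² + q ≤ n/2`, `40q ≤ n`; `(X, Y)` a tight-orthogonal psd
rectangle of dimension `r ≥ 1`, `A` a family of `t`-cuts, `B` a family of perfect matchings, `Dk` a weighted spread approximation of `(B, y)` for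
the trace weight `y(M) = tr(Y_M)/r` (parameter `τ`, cores `≤ q`), `i` one of its pieces. Assume the DENSE NON-CROSSING PSD CELL bound in every
reduced instance `K_m`, `n − 2q ≤ m ≤ n` (hypothesis `hH`: a tight psd strategy of `K_m` on `t''`-cuts × a family carrying a `(PM_m, τ)`-homogeneous
trace weight, both trace densities `≥ exp(−c₀ dq m)`, has value `≤ B_v·Ψ·r` against every reduced design of degree `D' ∈ [D − q, D]` on the levels
`C`; threshold `exp(−c₀ dq m) ≤ β`). Then `Σ_{U∈A} Σ_{M∈B, M∈ℱ_i} W(U,M)·tr(X_U Y_M) ≤ 4^q·B_v·r·√P_{D−4} + 2·4^q·(|⟨S_i⟩|/|PM_n|)·B_v·(Ψ + β)·r`.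
[cite: Rothvoss2017, §2 (PDF p. 6)] [cite: KupavskiiZakharov2022, Lemma 11] [cite: BrietDadushPokutta2014, Thm. 6 (§3)] -/
theorem psd_piece_value_le {c' T Dg q n₁ r : ℕ} {Bv τ c₀ β Ψ : ℝ} {C : Finset ℕ} {w : ℕ → ℝ} (hn : Even n) (hr : 0 < r)
    (hdes : IsExactDesign n (2 * c' + 1) T Dg Bv C w) (hDg : Dg ≤ 2 * c') (hDg4 : 4 ≤ Dg)
    (hbal : n ≤ 4 * (2 * c' + 1)) (hq : 40 * q ≤ n) (hn₁ : n₁ + 2 * q ≤ n)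
    (hTq : T + 2 * q + 2 ≤ 2 * c' + 1) (hqD : q ≤ Dg) (hDq3 : Dg + 2 * q + 3 ≤ 2 * c' + 1) (hqN : 2 * q * q + q ≤ n / 2)
    (hH : ∀ (m t'' D' : ℕ) (w' : ℕ → ℝ), n₁ ≤ m → Even m → Odd t'' → m ≤ 5 * t'' → m ≤ 5 * (m - t'') →
      T ≤ t'' → T ≤ m - t'' → D' + 3 ≤ t'' → D' + 3 ≤ m - t'' → Dg ≤ D' + q → D' ≤ Dg →
      (∀ c ∈ C, (Qset m t'' c).Nonempty) →
      (∀ p : Polynomial ℝ, p.natDegree ≤ D' → ∑ c ∈ C, w' c * p.eval (c : ℝ) = -p.eval 0) →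
      ∑ c ∈ C, |w' c| ≤ Bv →
      ∀ (X' : OddSet m → Matrix (Fin r) (Fin r) ℝ) (Y' : PMatch m → Matrix (Fin r) (Fin r) ℝ), IsPsdRect X' Y' →
      ∀ (A' : Finset (OddSet m)), (∀ U ∈ A', U.1.card = t'') →
      ∀ (B' : Finset (PMatch m)),
      IsRelHomogeneousW τ (perfectMatchings (univ : Finset (Fin m)))
        (fun M : Finset (Sym2 (Fin m)) => if hM : IsPMOn univ M then (Y' ⟨M, hM⟩).trace / r else 0) (B'.image Subtype.val) →
      Real.exp (-(c₀ * dq m)) ≤ (∑ U ∈ A', (X' U).trace) / ((r : ℝ) * (m.choose t'' : ℝ)) →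
      Real.exp (-(c₀ * dq m)) ≤ (∑ M ∈ B', (Y' M).trace) / ((r : ℝ) * (Fintype.card (PMatch m) : ℝ)) →
      ∑ U ∈ A', ∑ M ∈ B', levelWeight m t'' C w' U M * (X' U * Y' M).trace ≤ Bv * Ψ * r)
    (hΨ : 0 ≤ Ψ) (hβ : ∀ m : ℕ, n ≤ m + 2 * q → m ≤ n → Real.exp (-(c₀ * dq m)) ≤ β) (hβ0 : 0 ≤ β)
    {X : OddSet n → Matrix (Fin r) (Fin r) ℝ} {Y : PMatch n → Matrix (Fin r) (Fin r) ℝ} (hXY : IsPsdRect X Y)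
    (A : Finset (OddSet n)) (hA : ∀ U ∈ A, U.1.card = 2 * c' + 1) (B : Finset (PMatch n))
    (Dk : WeightedSpreadApproximation (perfectMatchings (univ : Finset (Fin n))) (B.image Subtype.val)
      (fun M : Finset (Sym2 (Fin n)) => if hM : IsPMOn univ M then (Y ⟨M, hM⟩).trace / r else 0) τ q) (i : Fin Dk.k) :
    ∑ U ∈ A, ∑ M ∈ B.filter (fun M => M.1 ∈ Dk.piece i), levelWeight n (2 * c' + 1) C w U M * (X U * Y M).trace ≤
      (4 : ℝ) ^ q * (Bv * ((r : ℝ) * Real.sqrt (∏ j ∈ range ((Dg - 4) / 2 + 1), ((2 * j + 1 : ℝ) / ((n : ℝ) - 2 * j))))) +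
        2 * (4 : ℝ) ^ q * (((supersets (perfectMatchings (univ : Finset (Fin n))) (Dk.core i)).card : ℝ) / Fintype.card (PMatch n)) *
          (Bv * (Ψ + β) * r) := by
  classical
  have hS : IsPMOn (verts (Dk.core i)) (Dk.core i) := isPMOn_verts_coreW (image_val_subset B) Dk i
  have hBiS : ∀ M ∈ B.filter (fun M => M.1 ∈ Dk.piece i), Dk.core i ⊆ M.1 :=
    fun M hM => Dk.core_subset_of_mem_piece (mem_filter.1 hM).2
  have hVcard : (verts (Dk.core i)).card = 2 * (Dk.core i).card := hS.two_mul_card.symm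
  have hSq : (Dk.core i).card ≤ q := Dk.card_core_le i
  have hBv : 0 ≤ Bv := (sum_nonneg fun c _ => abs_nonneg (w c)).trans hdes.2.2.2.2.2.2
  have hr' : (0 : ℝ) < r := by exact_mod_cast hr
  have ht2 : 2 * (2 * c' + 1) + 2 ≤ n := hdes.2.1
  set P : ℝ := ∏ j ∈ range ((Dg - 4) / 2 + 1), ((2 * j + 1 : ℝ) / ((n : ℝ) - 2 * j)) with hPdef
  have hP0 : 0 ≤ P := prod_nonneg fun j hj => (atten_factor_le_one (by have := mem_range.1 hj; omega)).1
  -- the star density of the core equals `|PM_m|/|PM_n|`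
  have hstar : ((supersets (perfectMatchings (univ : Finset (Fin n))) (Dk.core i)).card : ℝ) / Fintype.card (PMatch n) =
      (Fintype.card (PMatch (n - (verts (Dk.core i)).card)) : ℝ) / Fintype.card (PMatch n) := by
    rw [card_supersets_perfectMatchings_eq hS, card_pmatch_eq_pmCount (n := n - (verts (Dk.core i)).card)]
  -- the number of patterns
  have hcount : ∀ p : Finset (Fin n) → Prop, ∀ [DecidablePred p],
      ((((verts (Dk.core i)).powerset.filter p).card : ℝ)) ≤ (4 : ℝ) ^ q := by
    intro p _
    calc ((((verts (Dk.core i)).powerset.filter p).card : ℝ))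
        ≤ ((verts (Dk.core i)).powerset.card : ℝ) := by exact_mod_cast card_filter_le _ _
      _ = (2 : ℝ) ^ (2 * (Dk.core i).card) := by rw [card_powerset, hVcard]; push_cast; ring
      _ = (4 : ℝ) ^ (Dk.core i).card := by rw [pow_mul]; norm_num
      _ ≤ (4 : ℝ) ^ q := pow_le_pow_right₀ (by norm_num) hSq
  -- split by patterns
  rw [sum_eq_sum_patterns A (verts (Dk.core i))]
  rw [← sum_filter_add_sum_filter_not (verts (Dk.core i)).powerset (fun π => crossCount π (Dk.core i) = 0)]
  -- NON-CROSSING patterns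
  have hnc : ∑ π ∈ (verts (Dk.core i)).powerset.filter (fun π => crossCount π (Dk.core i) = 0),
      ∑ U ∈ A.filter (fun U => U.1 ∩ verts (Dk.core i) = π), ∑ M ∈ B.filter (fun M => M.1 ∈ Dk.piece i),
        levelWeight n (2 * c' + 1) C w U M * (X U * Y M).trace ≤
      2 * (4 : ℝ) ^ q * (((supersets (perfectMatchings (univ : Finset (Fin n))) (Dk.core i)).card : ℝ) / Fintype.card (PMatch n)) *
        (Bv * (Ψ + β) * r) := by
    have hcell : ∀ π ∈ (verts (Dk.core i)).powerset.filter (fun π => crossCount π (Dk.core i) = 0),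
        ∑ U ∈ A.filter (fun U => U.1 ∩ verts (Dk.core i) = π), ∑ M ∈ B.filter (fun M => M.1 ∈ Dk.piece i),
          levelWeight n (2 * c' + 1) C w U M * (X U * Y M).trace ≤
          2 * ((Fintype.card (PMatch (n - (verts (Dk.core i)).card)) : ℝ) / Fintype.card (PMatch n)) * (Bv * ((Ψ + β) * r)) := by
      intro π hπ
      obtain ⟨hπV, hπ0⟩ := mem_filter.1 hπ
      exact psd_noncrossing_pattern_le hn hr hdes hbal hq hn₁ hTq hqD hDq3 hqN hH hΨ hβ hβ0 hXY A hA B Dk i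
        (mem_powerset.1 hπV) hπ0
    refine (sum_le_sum hcell).trans ?_
    rw [sum_const, nsmul_eq_mul, hstar]
    have hnonneg : 0 ≤ 2 * ((Fintype.card (PMatch (n - (verts (Dk.core i)).card)) : ℝ) / Fintype.card (PMatch n)) *
        (Bv * ((Ψ + β) * r)) := by
      have := add_nonneg hΨ hβ0; positivity
    calc (((verts (Dk.core i)).powerset.filter (fun π => crossCount π (Dk.core i) = 0)).card : ℝ) *
          (2 * ((Fintype.card (PMatch (n - (verts (Dk.core i)).card)) : ℝ) / Fintype.card (PMatch n)) * (Bv * ((Ψ + β) * r)))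
        ≤ (4 : ℝ) ^ q * (2 * ((Fintype.card (PMatch (n - (verts (Dk.core i)).card)) : ℝ) / Fintype.card (PMatch n)) *
            (Bv * ((Ψ + β) * r))) := mul_le_mul_of_nonneg_right (hcount _) hnonneg
      _ = _ := by ring
  -- CROSSING patterns: the tracial crossing-pin lemma
  have hcr : ∑ π ∈ (verts (Dk.core i)).powerset.filter (fun π => ¬crossCount π (Dk.core i) = 0),
      ∑ U ∈ A.filter (fun U => U.1 ∩ verts (Dk.core i) = π), ∑ M ∈ B.filter (fun M => M.1 ∈ Dk.piece i),
        levelWeight n (2 * c' + 1) C w U M * (X U * Y M).trace ≤ (4 : ℝ) ^ q * (Bv * ((r : ℝ) * Real.sqrt P)) := by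
    have hcell : ∀ π ∈ (verts (Dk.core i)).powerset.filter (fun π => ¬crossCount π (Dk.core i) = 0),
        ∑ U ∈ A.filter (fun U => U.1 ∩ verts (Dk.core i) = π), ∑ M ∈ B.filter (fun M => M.1 ∈ Dk.piece i),
          levelWeight n (2 * c' + 1) C w U M * (X U * Y M).trace ≤ Bv * ((r : ℝ) * Real.sqrt P) := by
      intro π hπ
      obtain ⟨-, hπ0⟩ := mem_filter.1 hπ
      obtain ⟨e, he⟩ : ((Dk.core i).filter (Crosses π)).Nonempty := by
        rw [nonempty_iff_ne_empty]; intro h0; exact hπ0 (by rw [crossCount, h0, card_empty])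
      obtain ⟨heS, hecr⟩ := mem_filter.1 he
      have key : ∀ e' ∈ Dk.core i, Crosses π e' →
          |∑ U ∈ A.filter (fun U => U.1 ∩ verts (Dk.core i) = π), ∑ M ∈ B.filter (fun M => M.1 ∈ Dk.piece i),
            levelWeight n (2 * c' + 1) C w U M * (X U * Y M).trace| ≤ Bv * ((r : ℝ) * Real.sqrt P) := by
        intro e'
        induction e' using Sym2.ind with
        | h a b =>
          intro he' hcr'
          have hab : a ∈ verts (Dk.core i) ∧ b ∈ verts (Dk.core i) := Finset.mk_mem_sym2_iff.1 (hS.1 he')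
          exact abs_psd_crossing_cell_le hn hdes hDg hDg4 hab.1 hab.2 hcr' hXY A (B.filter fun M => M.1 ∈ Dk.piece i)
            (fun M hM => hBiS M hM he')
      exact (le_abs_self _).trans (key e heS hecr)
    refine (sum_le_sum hcell).trans ?_
    rw [sum_const, nsmul_eq_mul]
    exact mul_le_mul_of_nonneg_right (hcount _) (by positivity)
  linarith

end Summit.PneNP.PneNP.Theorems.ChebyshevTracialDesignPsdPieces
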